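import Summits.CriticalPhenomena.PercolationContinuityZ3.Theorems.PercNearOneGluingNoHeavyLowerTailHullPortMarkerDominanceTools
import HarnessLib

/-!
# Fresh-outside statistics are positively correlated given `{s ↮ X}`; the observer-union lemma for MDL(X)′
# (PAPER-2 track (ii): constants of the CSH family)

builds on p205010 (kernel theorem, internal audit signed; external expert review pending).  Support file (`--supports
stmt-CriticalPhenomena-4575`), seat `prim-consts-2` (gen 9); memo `run/shared/lean/prim/consts/FROM-prim-consts-2-g9-MDLXJOINT.md` §0(4), §3.
No definitions, no named facts, no sorries.

* `Consts.freshOutside_pair_posCorrelation` — **THEOREM (the between-world tool).**  Bond percolation `μ = prodBernoulli w`, `s ∉ X`,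
  `D_X = {s ↮ X}`, `W̄(C) = the pairs meeting {s} ∪ V(C)`.  For monotone nonnegative `h₁, h₂ : BondConfig V → ℝ` the statistics
  `Gᵢ(ω) = hᵢ(ω ∖ W̄(C_s ω))` ("`hᵢ` read on the fresh configuration off the cluster of `s`") satisfy
  `(∫_{D_X} G₁ dμ)(∫_{D_X} G₂ dμ) ≤ μ(D_X) · ∫_{D_X} G₁G₂ dμ`.
  Proof (van den Berg–Häggström–Kahn's pattern, pp. 7–8): given `{C_s = W}` the configuration off `W̄` is fresh
  (`BHK2006.sum_cond_cluster_sdiff`), so `∫_D Gᵢ = ∫_D ψᵢ(C_s)` with `ψᵢ(W) = E[hᵢ(η ∖ W̄(W))]` ANTITONE in `W`; Harris in `η` gives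
  `ψ₁ψ₂ ≤ ψ₁₂`; Theorem 1.3 (conditional positive association of `C_s` given `D_X`) for the antitone pair `ψ₁, ψ₂` finishes.
  (`HullPort.offCluster_pair_posCorrelation` is the special case of statistics `A(C_s)·H(ω)` with `H` local; here no locality
  hypothesis is needed because the statistic is DEFINED on the fresh configuration — this is the form the world decomposition of MDL(X)′ uses,
  memo §4: worlds `K = C_{x₀}`, between-world covariances of decreasing world-functions are `≥ 0`.)
* `Consts.obsUnion_posCorrelation` — **THEOREM (Lemma 1 of the memo).**  Owner `s`, ONE avoided vertex `x₀ ≠ s`, markers `y ≠ x₀`, `z`,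
  `D = {s ↮ x₀}`, `F` monotone in the edge cluster `C_s`, and the "observer union" `B' = {s ↔ z} ∪ ({y ↔ z} ∩ {y ↮ x₀})`:
  `(∫_D F(C_s) dμ) · μ(D ∩ B') ≤ μ(D) · ∫_{D ∩ B'} F(C_s) dμ`, i.e. `Cov(F(C_s), 1_{B'} | s ↮ x₀) ≥ 0`.
  This is the one universally nonnegative term in the decompositions of the `Consts.MDLXJoint` margin (memo §3 (*), (**)): with
  `1_{s↔z} = 1_{B'} − 1_{y↔z, y↮{s,x₀}}` the MDL(∅) proof pattern (`HullPort.markerDominance_noAvoid`) transposes to the avoided-set measure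
  `μ(·|s↮x₀)` except that its Harris step `Cov(F, 1_{s↔z ∨ y↔z} | s↮x₀) ≥ 0` is FALSE (K₄, weights ½: −7/256; the union may pass THROUGH x₀'s
  cluster); restricting the `y`-route to `{y ↮ x₀}` restores positivity — by `freshOutside_pair_posCorrelation` applied to the owner `x₀`
  with avoided set `{s}` and `h₁ = F(C_s(·))`, `h₂ = 1{z ∈ C_s(·) ∪ C_y(·)}` (on `D`, read off the configuration with `x₀`'s cluster deleted,
  these are `F(C_s)` and `1_{B'}`: `BHK2006.openEdgeCluster_eq_sdiff_bar`).
[cite: VandenbergHaggstromKahn2005, Thm. 1.3 (p. 6) and pp. 7–8 — corollaries, derived here]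
-/

noncomputable section

namespace Summit.CriticalPhenomena.PercolationContinuityZ3.Theorems

open MeasureTheory Set Literature.Probability.LatticeModels Literature.Probability.Percolation
open scoped Classical

namespace Consts

variable {V : Type*} [Fintype V]

open LonePortSum LonePortSumGeneral BHK2006 DecisionTree in
/-- **Fresh-outside statistics are positively correlated given `{s ↮ X}`.**  For `s ∉ X`, `D_X = {s ↮ X}` and monotone nonnegative
`h₁, h₂ : BondConfig V → ℝ`, the statistics `Gᵢ(ω) = hᵢ(ω ∖ W̄(C_s ω))` (`W̄(C)` = the pairs meeting `{s} ∪ V(C)`) satisfy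
`(∫_{D_X} G₁ dμ) · (∫_{D_X} G₂ dμ) ≤ μ(D_X) · ∫_{D_X} G₁ G₂ dμ`.
Proof: `∫_D Gᵢ = ∫_D ψᵢ(C_s)` with `ψᵢ(W) = E[hᵢ(η ∖ W̄(W))]` antitone (`BHK2006.sum_cond_cluster_sdiff`), Harris in `η`, then
Theorem 1.3 for the antitone pair. [cite: VandenbergHaggstromKahn2005, Thm. 1.3 (p. 6) and pp. 7–8 — corollary, derived here] -/
theorem freshOutside_pair_posCorrelation (w : Sym2 V → unitInterval) (s : V) (X : Set V) (hs : s ∉ X)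
    (h₁ h₂ : BondConfig V → ℝ) (hh₁ : Monotone h₁) (hh₂ : Monotone h₂) (h₁0 : ∀ ω, 0 ≤ h₁ ω) (h₂0 : ∀ ω, 0 ≤ h₂ ω) :
    (∫ ω in {ω : BondConfig V | ∀ x ∈ X, ¬ (openGraph ω).Reachable s x},
        h₁ (ω \ {e | ∃ v ∈ e, v = s ∨ ∃ e' ∈ openEdgeCluster ω s, v ∈ e'}) ∂(prodBernoulli w)) *
      (∫ ω in {ω : BondConfig V | ∀ x ∈ X, ¬ (openGraph ω).Reachable s x},
        h₂ (ω \ {e | ∃ v ∈ e, v = s ∨ ∃ e' ∈ openEdgeCluster ω s, v ∈ e'}) ∂(prodBernoulli w)) ≤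
    (prodBernoulli w).real {ω : BondConfig V | ∀ x ∈ X, ¬ (openGraph ω).Reachable s x} *
      ∫ ω in {ω : BondConfig V | ∀ x ∈ X, ¬ (openGraph ω).Reachable s x},
        h₁ (ω \ {e | ∃ v ∈ e, v = s ∨ ∃ e' ∈ openEdgeCluster ω s, v ∈ e'}) *
          h₂ (ω \ {e | ∃ v ∈ e, v = s ∨ ∃ e' ∈ openEdgeCluster ω s, v ∈ e'}) ∂(prodBernoulli w) := by
  classical
  set DX : Set (BondConfig V) := {ω | ∀ x ∈ X, ¬ (openGraph ω).Reachable s x} with hDX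
  set w' : Sym2 V → ℝ := fun e => (w e : ℝ) with hw'
  have hw0 : ∀ e, 0 ≤ w' e := fun e => (w e).2.1
  have hw1 : ∀ e, w' e ≤ 1 := fun e => (w e).2.2
  have hm : ∑ ω, weight w' ω = 1 := by
    have h1 := integral_prodBernoulli_eq_sum w fun _ => (1 : ℝ)
    simp only [integral_const, probReal_univ, smul_eq_mul, mul_one] at h1
    exact h1.symm
  -- `1_{D_X} = NX(C_s)`
  set NX : Set (Sym2 V) → ℝ := fun C => if ∀ x ∈ X, ¬ (x = s ∨ ∃ e ∈ C, x ∈ e) then 1 else 0 with hNX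
  have hind : ∀ ω : BondConfig V, ind DX ω = NX (openEdgeCluster ω s) := by
    intro ω
    by_cases hω : ω ∈ DX
    · have hω' : ∀ x ∈ X, ¬ (openGraph ω).Reachable s x := hω
      have h1 : ∀ x ∈ X, ¬ (x = s ∨ ∃ e ∈ openEdgeCluster ω s, x ∈ e) := fun x hx h =>
        hω' x hx ((reachable_iff_exists_mem_openEdgeCluster ω s x).2 h)
      rw [ind_of_mem hω, hNX]
      simp only [if_pos h1]
    · have hω' : ∃ x ∈ X, (openGraph ω).Reachable s x := by
        by_contra hcon
        exact hω fun x hx hr => hcon ⟨x, hx, hr⟩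
      obtain ⟨x, hx, hr⟩ := hω'
      have h1 : ¬ ∀ x ∈ X, ¬ (x = s ∨ ∃ e ∈ openEdgeCluster ω s, x ∈ e) := fun h =>
        h x hx ((reachable_iff_exists_mem_openEdgeCluster ω s x).1 hr)
      rw [ind_of_not_mem hω, hNX]
      simp only [if_neg h1]
  set bar : Set (Sym2 V) → Set (Sym2 V) := fun W => {e | ∃ v ∈ e, v = s ∨ ∃ e' ∈ W, v ∈ e'} with hbar
  -- conditional means
  set ψ₁ : Set (Sym2 V) → ℝ := fun W => ∑ η, weight w' η * h₁ (η \ bar W) with hψ₁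
  set ψ₂ : Set (Sym2 V) → ℝ := fun W => ∑ η, weight w' η * h₂ (η \ bar W) with hψ₂
  set ψ₁₂ : Set (Sym2 V) → ℝ := fun W => ∑ η, weight w' η * (h₁ (η \ bar W) * h₂ (η \ bar W)) with hψ₁₂
  have hψ₁anti : Antitone ψ₁ := by
    intro W W' hWW'
    refine Finset.sum_le_sum fun η _ => mul_le_mul_of_nonneg_left ?_ (weight_nonneg hw0 hw1 η)
    exact hh₁ (Set.sdiff_subset_sdiff_right (bar_mono s hWW'))
  have hψ₂anti : Antitone ψ₂ := by
    intro W W' hWW'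
    refine Finset.sum_le_sum fun η _ => mul_le_mul_of_nonneg_left ?_ (weight_nonneg hw0 hw1 η)
    exact hh₂ (Set.sdiff_subset_sdiff_right (bar_mono s hWW'))
  have hψ₁0 : ∀ W, 0 ≤ ψ₁ W := fun W =>
    Finset.sum_nonneg fun η _ => mul_nonneg (weight_nonneg hw0 hw1 η) (h₁0 _)
  have hψ₂0 : ∀ W, 0 ≤ ψ₂ W := fun W =>
    Finset.sum_nonneg fun η _ => mul_nonneg (weight_nonneg hw0 hw1 η) (h₂0 _)
  -- Harris in `η`
  have hHarris : ∀ W, ψ₁ W * ψ₂ W ≤ ψ₁₂ W := by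
    intro W
    have hf : Monotone fun η : Set (Sym2 V) => h₁ (η \ bar W) :=
      fun η η' h => hh₁ (Set.sdiff_subset_sdiff_left h)
    have hg : Monotone fun η : Set (Sym2 V) => h₂ (η \ bar W) :=
      fun η η' h => hh₂ (Set.sdiff_subset_sdiff_left h)
    have key := harris hw0 hw1 (f := fun η => h₁ (η \ bar W)) (g := fun η => h₂ (η \ bar W))
      (fun η => h₁0 _) (fun η => h₂0 _) hf hg
    rw [hm, one_mul] at key
    exact key
  -- `∫_D h(ω ∖ W̄) = ∫_D ψ(C_s)`
  have rewr : ∀ (h : BondConfig V → ℝ) (ψ : Set (Sym2 V) → ℝ),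
      (ψ = fun W => ∑ η, weight w' η * h (η \ bar W)) →
      ∫ ω in DX, h (ω \ {e | ∃ v ∈ e, v = s ∨ ∃ e' ∈ openEdgeCluster ω s, v ∈ e'}) ∂(prodBernoulli w) =
        ∫ ω in DX, ψ (openEdgeCluster ω s) ∂(prodBernoulli w) := by
    intro h ψ hψ
    rw [setIntegral_eq_sum w DX, setIntegral_eq_sum w DX]
    have e2 := sum_cond_cluster_sdiff w' hm s (fun C ξ => NX C * h ξ)
    have lhs : ∑ ω, weight w' ω * (h (ω \ {e | ∃ v ∈ e, v = s ∨ ∃ e' ∈ openEdgeCluster ω s, v ∈ e'}) * ind DX ω) =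
        ∑ ω, weight w' ω * ((fun C ξ => NX C * h ξ) (openEdgeCluster ω s)
          (ω \ {e | ∃ v ∈ e, v = s ∨ ∃ e' ∈ openEdgeCluster ω s, v ∈ e'})) :=
      Finset.sum_congr rfl fun ω _ => by simp only; rw [hind ω]; ring
    rw [lhs, e2]
    refine Finset.sum_congr rfl fun ω _ => ?_
    rw [hind ω, hψ]
    simp only [Finset.mul_sum, Finset.sum_mul, hbar]
    refine Finset.sum_congr rfl fun η _ => ?_
    ring
  have i1 := rewr h₁ ψ₁ rfl
  have i2 := rewr h₂ ψ₂ rfl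
  have i12 := rewr (fun ω => h₁ ω * h₂ ω) ψ₁₂ rfl
  have hDm : MeasurableSet DX := MeasurableSet.of_discrete
  -- `∫_D ψ₁ψ₂(C_s) ≤ ∫_D ψ₁₂(C_s) = ∫_D G₁G₂`
  have step1 : ∫ ω in DX, ψ₁ (openEdgeCluster ω s) * ψ₂ (openEdgeCluster ω s) ∂(prodBernoulli w) ≤
      ∫ ω in DX, h₁ (ω \ {e | ∃ v ∈ e, v = s ∨ ∃ e' ∈ openEdgeCluster ω s, v ∈ e'}) *
        h₂ (ω \ {e | ∃ v ∈ e, v = s ∨ ∃ e' ∈ openEdgeCluster ω s, v ∈ e'}) ∂(prodBernoulli w) := by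
    have e : ∫ ω in DX, h₁ (ω \ {e | ∃ v ∈ e, v = s ∨ ∃ e' ∈ openEdgeCluster ω s, v ∈ e'}) *
        h₂ (ω \ {e | ∃ v ∈ e, v = s ∨ ∃ e' ∈ openEdgeCluster ω s, v ∈ e'}) ∂(prodBernoulli w) =
        ∫ ω in DX, (fun ω => h₁ ω * h₂ ω) (ω \ {e | ∃ v ∈ e, v = s ∨ ∃ e' ∈ openEdgeCluster ω s, v ∈ e'})
          ∂(prodBernoulli w) := rfl
    rw [e, i12]
    exact setIntegral_mono_on (Integrable.of_finite).integrableOn (Integrable.of_finite).integrableOn hDm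
      fun ω _ => hHarris _
  -- Theorem 1.3 for the antitone pair `ψ₁, ψ₂`
  have h13 := BHK2006_clusterConditionalPositiveAssociation_holds V w s X
    (fun C => -ψ₁ C) (fun C => -ψ₂ C) (fun _ _ h => neg_le_neg (hψ₁anti h)) (fun _ _ h => neg_le_neg (hψ₂anti h)) hs
  simp only [integral_neg, mul_neg, neg_mul, neg_neg] at h13
  change (∫ ω in DX, ψ₁ (openEdgeCluster ω s) ∂(prodBernoulli w)) * (∫ ω in DX, ψ₂ (openEdgeCluster ω s) ∂(prodBernoulli w)) ≤
    (prodBernoulli w).real DX * ∫ ω in DX, ψ₁ (openEdgeCluster ω s) * ψ₂ (openEdgeCluster ω s) ∂(prodBernoulli w) at h13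
  rw [i1, i2]
  exact h13.trans (mul_le_mul_of_nonneg_left step1 measureReal_nonneg)

open LonePortSum LonePortSumGeneral BHK2006 DecisionTree in
/-- **Observer-union lemma (Lemma 1 for MDL(X)′).**  Owner `s`, one avoided vertex `x₀ ≠ s`, markers `y ≠ x₀` and `z ≠ y`,
`D = {s ↮ x₀}`, `B' = {s ↔ z} ∪ ({y ↔ z} ∩ {y ↮ x₀})`, `F` monotone in the edge cluster of `s`:
`(∫_D F(C_s) dμ) · μ(D ∩ B') ≤ μ(D) · ∫_{D ∩ B'} F(C_s) dμ` (`Cov(F(C_s), 1_{B'} | s ↮ x₀) ≥ 0`).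
Proof: on `D`, `F(C_s) − F ∅` and `1_{B'}` are the monotone statistics `F(C_s(ξ)) − F ∅` and `1{s ↔ z or y ↔ z in ξ}` of the fresh
configuration `ξ = ω ∖ W̄(C_{x₀} ω)` (`BHK2006.openEdgeCluster_eq_sdiff_bar`, `LonePortSumGeneral.reachable_sdiff_bar_iff`; if `y ↔ x₀`
then `y` is isolated in `ξ`), so `freshOutside_pair_posCorrelation` (owner `x₀`, avoided set `{s}`) applies.  The unrestricted union
`{s ↔ z} ∪ {y ↔ z}` is NOT positively correlated with `F(C_s)` given `s ↮ x₀` (K₄, weights ½: covariance −7/256).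
[cite: VandenbergHaggstromKahn2005, Thm. 1.3 (p. 6) and pp. 7–8 — corollary, derived here] -/
theorem obsUnion_posCorrelation (w : Sym2 V → unitInterval) (s x₀ y z : V) (hs : s ≠ x₀) (hy : y ≠ x₀) (hzy : z ≠ y)
    (F : Set (Sym2 V) → ℝ) (hF : Monotone F) :
    (∫ ω in {ω : BondConfig V | ¬ (openGraph ω).Reachable s x₀}, F (openEdgeCluster ω s) ∂(prodBernoulli w)) *
      (prodBernoulli w).real ({ω : BondConfig V | ¬ (openGraph ω).Reachable s x₀} ∩
        (openConn s z ∪ (openConn y z ∩ {ω | ¬ (openGraph ω).Reachable y x₀}))) ≤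
    (prodBernoulli w).real {ω : BondConfig V | ¬ (openGraph ω).Reachable s x₀} *
      ∫ ω in {ω : BondConfig V | ¬ (openGraph ω).Reachable s x₀} ∩
          (openConn s z ∪ (openConn y z ∩ {ω | ¬ (openGraph ω).Reachable y x₀})),
        F (openEdgeCluster ω s) ∂(prodBernoulli w) := by
  classical
  set μ := prodBernoulli w with hμ
  set D : Set (BondConfig V) := {ω | ¬ (openGraph ω).Reachable s x₀} with hD
  set B : Set (BondConfig V) := openConn s z ∪ (openConn y z ∩ {ω | ¬ (openGraph ω).Reachable y x₀}) with hB
  have hmeas : ∀ S : Set (BondConfig V), MeasurableSet S := fun _ => MeasurableSet.of_discrete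
  -- the avoided set `{s}` for the owner `x₀`
  have hx : x₀ ∉ ({s} : Set V) := fun h => hs (mem_singleton_iff.1 h).symm
  have hDX : {ω : BondConfig V | ∀ x ∈ ({s} : Set V), ¬ (openGraph ω).Reachable x₀ x} = D := by
    ext ω
    simp only [mem_setOf_eq, mem_singleton_iff, forall_eq, hD]
    exact ⟨fun h hr => h hr.symm, fun h hr => h hr.symm⟩
  -- the two statistics of the fresh configuration
  set h₁ : BondConfig V → ℝ := fun ξ => F (openEdgeCluster ξ s) - F ∅ with hh₁
  set h₂ : BondConfig V → ℝ := fun ξ =>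
    if (openGraph ξ).Reachable s z ∨ (openGraph ξ).Reachable y z then 1 else 0 with hh₂
  have hh₁m : Monotone h₁ := fun ξ ξ' h => sub_le_sub_right (hF (openEdgeCluster_mono h s)) _
  have hh₂m : Monotone h₂ := by
    intro ξ ξ' h
    simp only [hh₂]
    by_cases hc : (openGraph ξ).Reachable s z ∨ (openGraph ξ).Reachable y z
    · have hc' : (openGraph ξ').Reachable s z ∨ (openGraph ξ').Reachable y z :=
        hc.imp (fun hr => hr.mono (openGraph_mono h)) (fun hr => hr.mono (openGraph_mono h))
      rw [if_pos hc, if_pos hc']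
    · rw [if_neg hc]
      split_ifs <;> norm_num
  have hh₁0 : ∀ ξ, 0 ≤ h₁ ξ := fun ξ => sub_nonneg.2 (hF (empty_subset _))
  have hh₂0 : ∀ ξ, 0 ≤ h₂ ξ := fun ξ => by
    simp only [hh₂]
    split_ifs <;> norm_num
  have key := freshOutside_pair_posCorrelation w x₀ ({s} : Set V) hx h₁ h₂ hh₁m hh₂m hh₁0 hh₂0
  rw [hDX] at key
  -- on `D`, the statistics are `F(C_s) − F ∅` and `1_B`
  have hCs : ∀ ω ∈ D, openEdgeCluster (ω \ {e | ∃ v ∈ e, v = x₀ ∨ ∃ e' ∈ openEdgeCluster ω x₀, v ∈ e'}) s =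
      openEdgeCluster ω s := by
    intro ω hω
    have hns : ¬ (s = x₀ ∨ ∃ e ∈ openEdgeCluster ω x₀, s ∈ e) := fun h =>
      hω (((reachable_iff_exists_mem_openEdgeCluster ω x₀ s).2 h).symm)
    exact (openEdgeCluster_eq_sdiff_bar (rfl : openEdgeCluster ω x₀ = openEdgeCluster ω x₀) hns).symm
  have hG₁ : ∀ ω ∈ D, h₁ (ω \ {e | ∃ v ∈ e, v = x₀ ∨ ∃ e' ∈ openEdgeCluster ω x₀, v ∈ e'}) =
      F (openEdgeCluster ω s) - F ∅ := by
    intro ω hω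
    simp only [hh₁, hCs ω hω]
  have hG₂ : ∀ ω ∈ D, h₂ (ω \ {e | ∃ v ∈ e, v = x₀ ∨ ∃ e' ∈ openEdgeCluster ω x₀, v ∈ e'}) =
      B.indicator (1 : BondConfig V → ℝ) ω := by
    intro ω hω
    have hsz : (openGraph (ω \ {e | ∃ v ∈ e, v = x₀ ∨ ∃ e' ∈ openEdgeCluster ω x₀, v ∈ e'})).Reachable s z ↔
        (openGraph ω).Reachable s z :=
      reachable_sdiff_bar_iff (fun h => hω h.symm) z
    -- the `y`-route off `W̄(C_{x₀})` is exactly `{y ↔ z} ∩ {y ↮ x₀}`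
    have hyz : (openGraph (ω \ {e | ∃ v ∈ e, v = x₀ ∨ ∃ e' ∈ openEdgeCluster ω x₀, v ∈ e'})).Reachable y z ↔
        (openGraph ω).Reachable y z ∧ ¬ (openGraph ω).Reachable y x₀ := by
      by_cases hyx : (openGraph ω).Reachable y x₀
      · -- `y` is in the cluster of `x₀`: every pair at `y` is deleted, so `y` reaches only itself
        have hyin : ∃ e' ∈ openEdgeCluster ω x₀, y ∈ e' :=
          ((reachable_iff_exists_mem_openEdgeCluster ω x₀ y).1 hyx.symm).resolve_left hy
        constructor
        · intro hr
          exfalso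
          obtain ⟨p⟩ := hr
          cases p with
          | nil => exact hzy rfl
          | cons hadj _ =>
            rw [openGraph_adj] at hadj
            exact hadj.1.2 ⟨y, Sym2.mem_mk_left _ _, Or.inr hyin⟩
        · exact fun h => (h.2 hyx).elim
      · have e := reachable_sdiff_bar_iff (fun h => hyx h.symm) z
        exact ⟨fun h => ⟨e.1 h, hyx⟩, fun h => e.2 h.1⟩
    have hBiff : ω ∈ B ↔ (openGraph ω).Reachable s z ∨ ((openGraph ω).Reachable y z ∧ ¬ (openGraph ω).Reachable y x₀) := by
      simp only [hB, openConn, mem_union, mem_inter_iff, mem_setOf_eq]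
    by_cases hb : ω ∈ B
    · rw [indicator_of_mem hb, Pi.one_apply, hh₂]
      simp only [hsz, hyz, if_pos (hBiff.1 hb)]
    · rw [indicator_of_notMem hb, hh₂]
      simp only [hsz, hyz, if_neg (fun h => hb (hBiff.2 h))]
  -- rewrite the three integrals of `key`
  have hDm : MeasurableSet D := hmeas D
  have e1 : ∫ ω in D, h₁ (ω \ {e | ∃ v ∈ e, v = x₀ ∨ ∃ e' ∈ openEdgeCluster ω x₀, v ∈ e'}) ∂μ =
      (∫ ω in D, F (openEdgeCluster ω s) ∂μ) - F ∅ * μ.real D := by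
    rw [setIntegral_congr_fun hDm hG₁, integral_sub (Integrable.of_finite) (Integrable.of_finite),
      setIntegral_const, smul_eq_mul, mul_comm]
  have e2 : ∫ ω in D, h₂ (ω \ {e | ∃ v ∈ e, v = x₀ ∨ ∃ e' ∈ openEdgeCluster ω x₀, v ∈ e'}) ∂μ = μ.real (D ∩ B) := by
    rw [setIntegral_congr_fun hDm hG₂]
    exact KNPreFKG.setIntegral_indicator_one_eq μ D B
  have e3 : ∫ ω in D, h₁ (ω \ {e | ∃ v ∈ e, v = x₀ ∨ ∃ e' ∈ openEdgeCluster ω x₀, v ∈ e'}) *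
        h₂ (ω \ {e | ∃ v ∈ e, v = x₀ ∨ ∃ e' ∈ openEdgeCluster ω x₀, v ∈ e'}) ∂μ =
      (∫ ω in D ∩ B, F (openEdgeCluster ω s) ∂μ) - F ∅ * μ.real (D ∩ B) := by
    have hc : ∀ ω ∈ D, h₁ (ω \ {e | ∃ v ∈ e, v = x₀ ∨ ∃ e' ∈ openEdgeCluster ω x₀, v ∈ e'}) *
        h₂ (ω \ {e | ∃ v ∈ e, v = x₀ ∨ ∃ e' ∈ openEdgeCluster ω x₀, v ∈ e'}) =
        B.indicator (fun ω => F (openEdgeCluster ω s) - F ∅) ω := by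
      intro ω hω
      rw [hG₁ ω hω, hG₂ ω hω]
      by_cases hb : ω ∈ B
      · rw [indicator_of_mem hb, indicator_of_mem hb, Pi.one_apply, mul_one]
      · rw [indicator_of_notMem hb, indicator_of_notMem hb, mul_zero]
    rw [setIntegral_congr_fun hDm hc, setIntegral_indicator (hmeas B), integral_sub (Integrable.of_finite) (Integrable.of_finite),
      setIntegral_const, smul_eq_mul, mul_comm]
  rw [e1, e2, e3] at key
  -- `key : (I − F∅·μD)·μ(D∩B) ≤ μD·(I_B − F∅·μ(D∩B))`; the `F ∅` terms cancel
  have h0 : 0 ≤ μ.real D := measureReal_nonneg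
  nlinarith [key, h0]

end Consts

end Summit.CriticalPhenomena.PercolationContinuityZ3.Theorems

end
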